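import Literature.Algebra.Lie.LefschetzInvariantFormExistence
import Literature.Algebra.Lie.LefschetzModuleKleimanAlgebraMatrix
import Mathlib.LinearAlgebra.FreeModule.Finite.Matrix
import HarnessLib

/-!
# The invariant bilinear forms of an `𝔰𝔩₂`-representation are the families of forms on its primitive spaces (Looijenga–Lunts 1997, §1 (1.16), first sentence, for reducible modules)

Topic `Literature/Algebra/Lie` (namespace `Literature.Algebra.Lie`).  Lane `lit-hodgefound` (Track 2 foundations
library), skeleton seat `lit-hodgefound-skel-1` (generation 44), row **A1-129** of
`run/shared/lean/pub/lit-hodgefound/SKELETON.md`, the sequel of A1-128 `LefschetzInvariantFormExistence.lean`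
(the forms `φ_β` built from forms `β_k` on the primitive spaces) closing its SCOPE (a): **every** invariant bilinear
form of a finite-dimensional `𝔰𝔩₂`-representation `M` is a `φ_β`, namely for `β_k(p, q) = φ(p, eᵏ q)` its
"primitive forms" (A1-125), and `φ ↦ (β_k)_k` is a linear bijection
`{invariant forms on M} ≅ Π_{k < dim M} Bilin(P_{-k})` — Looijenga–Lunts' recollection "the `𝔰𝔩(2)`-invariant
bilinear forms on `V(k)` are generated by a nonzero `(-)^k`-symmetric form" (formalised for ONE string in A1-123
`LefschetzStringInvariantForm.lean`) carried to an arbitrary module `M ≅ ⊕ₖ V(k) ⊗ P_{-k}`: the invariant forms are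
exactly the `⊕ₖ ψ_k ⊗ β_k` with `ψ_k` the `(-1)^k`-symmetric form of `V(k)` and `β_k` ANY bilinear form on the
multiplicity space; the space of invariant forms has dimension `Σ_k m_k²` (`m_k = dim P_{-k}`); symmetry and
non-degeneracy of `φ` are read off the `β_k` (the "So …" of (1.16), both directions at once).  Vocabulary as in
the series: `(M, h)` `ℤ`-graded (`IsZGrading`), a Lefschetz operator `e` (`HasLefschetzProperty h e`, equivalently an
`𝔰𝔩₂`-triple `(e, h, f)` by A1-88 (1.1)), invariant = `h`- and `e`-skew-adjoint, `P_{-k} = primitiveSpace h e k`,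
characteristic `0`, finite dimension.  DEFINITIONS WITH BODIES (`primitiveForms`, `invariantForms`,
`HasLefschetzProperty.invariantFormsEquiv`) and PROVED theorems; no named fact, no `sorry`, no instance, no
notation (D-0026 net debt `0`).  `LieRing.ofAssociativeRing` is enabled FILE-LOCALLY as in every parent file.

## Source, VERBATIM

E. Looijenga, V. A. Lunts, *A Lie algebra attached to a projective variety*, Invent. Math. **129** (1997) 361–412,
§1 (1.16) (held TeX text `paper:arxiv-alg-geom_9604014`, p0008 L77–L83):

> "Let us recall that the `𝔰𝔩(2)`-invariant bilinear forms on `V(k)` are generated by a nonzero `(-)^k`-symmetric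
> form. So an finite dimensional `𝔰𝔩(2)`-representation of even parity always admits a nondegenerate invariant
> symmetric form, whereas it admits a nondegenerate invariant skew-symmetric form if and only if all multiplicities
> are even. In the case of odd parity it is just the other way around."

with §1 (1.3) p0005 L1–L5 ("an invariant bilinear form on `M` is a bilinear map `φ : M × M → K` that defines a
morphism of Lefschetz modules `M ⊗ M → K` […]: so `φ` is zero on `M_k × M_l` unless `k + l = 0` and `𝔞` preserves
the form `φ` infinitesimally: `φ(e_a m, m') + φ(m, e_a m') = 0`") and the primitive decomposition of (1.6) (proof,
p0006 L10–L12: "`N = ⊕_{k≥0} ℂ[e] P_{-k}(N)`, where `P_{-k}(N) := Ker(e_a^{k+1}|N_{-k})`").  The step from the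
first printed sentence (one string) to the second (a reducible representation) is the decomposition of an invariant
form along `M ≅ ⊕ₖ V(k) ⊗ P_{-k}`; this file makes that step explicit and two-sided.

## Rendering (dictionary)

* "invariant bilinear form on `M`": `B : LinearMap.BilinForm K M` with `B.IsSkewAdjoint h ∧ B.IsSkewAdjoint e`; the
  subspace of these is `invariantForms h e : Submodule K (BilinForm K M)`.
* "the form on the multiplicity space of `V(k)`": `primitiveForms h e B k : BilinForm K (primitiveSpace h e k)`,
  `(p, q) ↦ B p (eᵏ q)` (the induced form `β_k` of A1-125, `φ(p, aᵏq)` on `P_{-k}`).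
* "`M ≅ ⊕ₖ V(k) ⊗ P_{-k}`", "`ψ_k ⊗ β_k`": A1-128's string coordinates and `HasLefschetzProperty.stringForm`
  (`φ_β(eᵃp, eᵇq) = (-1)ᵃ δ_{a+b,k} β_k(p, q)`).

## Contents (all proved)

* §1 values of an ARBITRARY invariant form on strings: `apply_pow_eq_neg_one_pow_mul` (`φ(x, eᵐy) = (-1)ᵐ φ(eᵐx, y)`),
  **`apply_pow_primitive_pow_primitive_of_ne`** (`φ(eᵃp, eᵇq) = 0` for `p ∈ P_{-k₁}`, `q ∈ P_{-k₂}`, `k₁ ≠ k₂`: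
  distinct isotypic components are orthogonal for every invariant form), **`apply_pow_primitive_pow_primitive`**
  (`φ(eᵃp, eᵇq) = (-1)ᵃ δ_{a+b,k} φ(p, eᵏq)` inside one component).
* §2 `primitiveForms` and **`HasLefschetzProperty.eq_stringForm_primitiveForms`** (every invariant `φ` equals
  `φ_β` for `β` = its primitive forms, any `D ≥ dim M`, any string reversal), **`ext_of_primitiveForms_eq`** (an
  invariant form is determined by the values `φ(p, eᵏq)`, `p, q ∈ P_{-k}`, `k < dim M`), `primitiveForms_stringForm`
  (the primitive forms of `φ_β` are the `β_k`).
* §3 `invariantForms` (a subspace), **`HasLefschetzProperty.invariantFormsEquiv`**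
  (`invariantForms h e ≃ₗ[K] Π_{k < D} BilinForm K (P_{-k})` for `D ≥ dim M`), `invariantFormsEquiv_apply`, and
  **`finrank_invariantForms`** (`dim {invariant forms} = Σ_{k < D} (dim P_{-k})²`).
* §5 bridge (asked for by the review of A1-128): `stringCoord_lefschetzInvolution_eq_stringUnit`
  (`C_{k,i}` for `*_L` = the matrix unit `E⁽ᵏ⁾_{0i}` of `LefschetzModuleKleimanAlgebraMatrix.lean`, seat p34 row g30-#5) and
  `stringCoord_lefschetzInvolution_zero_eq_primitiveProj` (`C_{k,0} = π_k`).
* §4 transfer: **`flip_eq_smul_iff_primitiveForms`** (`φᵀ = εφ` iff every `β_k` is `ε(-1)^k`-symmetric — "only if"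
  is A1-125 `primitiveForm_apply_swap`), **`nondegenerate_iff_primitiveForms`** (for `φᵀ = εφ`: `φ` non-degenerate iff
  every `β_k`, `k < dim M`, is left-separating — "only if" is A1-125 `exists_primitive_apply_pow_ne_zero`).

## SCOPE

(a) The identification is stated for the pair `(h, e)`; invariance under the partner `f` is automatic for
non-degenerate forms (A1-88 `isSkewAdjoint_dual`) and is not tracked for degenerate ones.  (b) No multiplicative /
algebra structure on the invariant forms is considered.  (c) Nothing here concerns complex tori or the Hodge
conjecture.

## References

* [LooijengaLunts1997] E. Looijenga, V. A. Lunts, *A Lie algebra attached to a projective variety*, Invent. Math.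
  129 (1997) 361–412; arXiv:alg-geom/9604014. §1 (1.16), p. 8 L77–L83 of the held TeX text; (1.3) p. 5 L1–L5;
  (1.6) proof, p. 6 L10–L12.
* [FultonHarris1991] W. Fulton, J. Harris, *Representation Theory: A First Course*, GTM 129, Springer (1991),
  Lecture 11, Exercises 11.11, 11.33 (one invariant form on `Symⁿ V`, in `Sym²` or `Λ²` by parity of `n`) — as
  cited in A1-123.
-/

noncomputable section

namespace Literature.Algebra.Lie

open Module Function Set
open LinearMap (BilinForm)
open HasLefschetzProperty (primitiveSpace mem_primitiveSpace_iff)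

-- The commutator Lie ring of `𝔤𝔩(M) = Module.End K M`: Mathlib's reducible NON-instance, enabled file-locally
-- exactly as in `LefschetzModule.lean`.
attribute [local instance 100] LieRing.ofAssociativeRing

variable {K : Type*} [Field K] {M : Type*} [AddCommGroup M] [Module K M] {B : BilinForm K M}
  {h e s : Module.End K M}

/-! ### §1 An invariant form on strings: orthogonal isotypic components, `(-1)ᵃ δ_{a+b,k} φ(p, eᵏq)` inside -/

section Values

variable [CharZero K]

omit [CharZero K] in
/-- Moving all powers of a skew operator to the LEFT: `φ(x, eᵐ y) = (-1)ᵐ φ(eᵐ x, y)`.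
[cite: LooijengaLunts1997, §1 (1.3) p0005 L4–L5 ("φ(e_a m, m') + φ(m, e_a m') = 0")] -/
theorem apply_pow_eq_neg_one_pow_mul (he : B.IsSkewAdjoint e) (x y : M) (m : ℕ) :
    B x ((e ^ m) y) = (-1 : K) ^ m * B ((e ^ m) x) y := by
  have h1 := apply_pow_pow_eq_of_isSkewAdjoint he x y m 0
  rw [pow_zero, Module.End.one_apply, add_zero, smul_eq_mul] at h1
  rw [h1, ← mul_assoc, ← mul_pow, neg_one_mul, neg_neg, one_pow, one_mul]

/-- **Strings of different lengths are orthogonal for EVERY invariant form**: `φ(eᵃ p, eᵇ q) = 0` for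
`p ∈ P_{-k₁}`, `q ∈ P_{-k₂}`, `k₁ ≠ k₂` (move the powers of `e` onto the shorter string: either they kill its
primitive vector or the degrees do not add up to `0`). [cite: LooijengaLunts1997, §1 (1.3) p0005 L3–L5] [cite: LooijengaLunts1997, §1 (1.16) p0008 L77–L79] -/
theorem apply_pow_primitive_pow_primitive_of_ne (L : HasLefschetzProperty h e) (hh : B.IsSkewAdjoint h)
    (he : B.IsSkewAdjoint e) {k₁ k₂ : ℕ} {p q : M} (hp : p ∈ primitiveSpace h e k₁)
    (hq : q ∈ primitiveSpace h e k₂) (hk : k₁ ≠ k₂) (a b : ℕ) : B ((e ^ a) p) ((e ^ b) q) = 0 := by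
  rcases lt_or_gt_of_ne hk with hlt | hlt
  · -- move everything onto `p`
    rw [apply_pow_eq_neg_one_pow_mul he, ← Module.End.mul_apply, ← pow_add]
    by_cases hab : k₁ < b + a
    · rw [pow_apply_primitive_of_lt hp hab, map_zero, LinearMap.zero_apply, mul_zero]
    · rw [apply_eq_zero_of_isSkewAdjoint_of_mem_degreeSpace hh (k := -(k₁ : ℤ) + 2 * (b + a : ℕ))
        (l := -(k₂ : ℤ)) (by push_cast; omega) (L.pow_apply_mem (mem_primitiveSpace_iff.1 hp).1 _)
        (mem_primitiveSpace_iff.1 hq).1, mul_zero]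
  · -- move everything onto `q`
    rw [apply_pow_pow_eq_of_isSkewAdjoint he, smul_eq_mul]
    by_cases hab : k₂ < a + b
    · rw [pow_apply_primitive_of_lt hq hab, map_zero, mul_zero]
    · rw [apply_eq_zero_of_isSkewAdjoint_of_mem_degreeSpace hh (k := -(k₁ : ℤ))
        (l := -(k₂ : ℤ) + 2 * (a + b : ℕ)) (by push_cast; omega) (mem_primitiveSpace_iff.1 hp).1
        (L.pow_apply_mem (mem_primitiveSpace_iff.1 hq).1 _), mul_zero]

/-- **Inside one isotypic component every invariant form is `ψ_k ⊗ β_k`**: `φ(eᵃ p, eᵇ q) = (-1)ᵃ δ_{a+b,k} φ(p, eᵏ q)`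
for `p, q ∈ P_{-k}` — the `(-1)^k`-symmetric form of `V(k)` (A1-123) times the "primitive form"
`β_k(p, q) = φ(p, eᵏ q)` of A1-125. [cite: LooijengaLunts1997, §1 (1.16) p0008 L77–L79 ("the 𝔰𝔩(2)-invariant bilinear forms on V(k) are generated by a nonzero (−)^k-symmetric form")] -/
theorem apply_pow_primitive_pow_primitive (L : HasLefschetzProperty h e) (hh : B.IsSkewAdjoint h)
    (he : B.IsSkewAdjoint e) {k : ℕ} {p q : M} (hp : p ∈ primitiveSpace h e k) (hq : q ∈ primitiveSpace h e k)
    (a b : ℕ) : B ((e ^ a) p) ((e ^ b) q) = if a + b = k then (-1 : K) ^ a * B p ((e ^ k) q) else 0 := by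
  rw [apply_pow_pow_eq_of_isSkewAdjoint he, smul_eq_mul]
  by_cases hab : a + b = k
  · rw [if_pos hab, hab]
  · rw [if_neg hab]
    rcases Nat.lt_or_gt_of_ne hab with hlt | hlt
    · rw [apply_eq_zero_of_isSkewAdjoint_of_mem_degreeSpace hh (k := -(k : ℤ)) (l := -(k : ℤ) + 2 * (a + b : ℕ))
        (by push_cast; omega) (mem_primitiveSpace_iff.1 hp).1 (L.pow_apply_mem (mem_primitiveSpace_iff.1 hq).1 _),
        mul_zero]
    · rw [pow_apply_primitive_of_lt hq hlt, map_zero, mul_zero]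

end Values

/-! ### §2 Every invariant form is a `φ_β`: `β_k` = its primitive forms -/

section Classification

variable [CharZero K] [FiniteDimensional K M]

variable (h e) in
/-- **The primitive forms of `φ`**: `β_k(p, q) = φ(p, eᵏ q)` on `P_{-k}` (A1-125's induced form, as a family in `k`).
[cite: LooijengaLunts1997, §1 (1.16) p0008 L77–L83] -/
def primitiveForms (B : BilinForm K M) (k : ℕ) : BilinForm K (primitiveSpace h e k) :=
  B.compl₁₂ (primitiveSpace h e k).subtype ((e ^ k) ∘ₗ (primitiveSpace h e k).subtype)

omit [CharZero K] [FiniteDimensional K M] in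
/-- Unfolding the primitive forms. [cite: LooijengaLunts1997, §1 (1.16) p0008 L77–L83] -/
@[simp] theorem primitiveForms_apply (B : BilinForm K M) (k : ℕ) (p q : primitiveSpace h e k) :
    primitiveForms h e B k p q = B (p : M) ((e ^ k) (q : M)) := rfl

namespace HasLefschetzProperty

/-- **Every invariant bilinear form is the form `φ_β` of its own primitive forms** (`D ≥ dim M`, any string
reversal `s`): `φ = Σ_k Σ_{i ≤ k} (-1)ⁱ β_k(C_{k,i} ·, C_{k,k-i} ·)` with `β_k(p, q) = φ(p, eᵏ q)` — i.e. under
`M ≅ ⊕ₖ V(k) ⊗ P_{-k}` the invariant forms are exactly the `⊕ₖ ψ_k ⊗ β_k` ("generated by a nonzero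
`(−)^k`-symmetric form", for a reducible module). [cite: LooijengaLunts1997, §1 (1.16) p0008 L77–L79] -/
theorem eq_stringForm_primitiveForms (L : HasLefschetzProperty h e) (hgr : IsZGrading h)
    (hs : IsStringReversal h e s) (hh : B.IsSkewAdjoint h) (he : B.IsSkewAdjoint e) {D : ℕ}
    (hD : finrank K M ≤ D) : B = L.stringForm hgr hs (primitiveForms h e B) D := by
  refine L.bilinForm_ext_of_strings hgr fun k₁ p hp a _ k₂ q hq b _ ↦ ?_
  by_cases hk : k₁ = k₂
  · subst hk
    by_cases hkD : k₁ < D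
    · rw [L.stringForm_apply_pow_pow hgr hs hp hq hkD, apply_pow_primitive_pow_primitive L hh he hp hq,
        primitiveForms_apply]
    · rw [L.primitive_eq_zero_of_finrank_le (le_trans hD (not_lt.1 hkD)) hp, map_zero, map_zero,
        LinearMap.zero_apply, map_zero, LinearMap.zero_apply]
  · rw [L.stringForm_apply_pow_pow_of_ne hgr hs hp hq hk, apply_pow_primitive_pow_primitive_of_ne L hh he hp hq hk]

/-- **Uniqueness: an invariant form is determined by its primitive forms** `φ(p, eᵏ q)`, `p, q ∈ P_{-k}`,
`k < dim M`. [cite: LooijengaLunts1997, §1 (1.16) p0008 L77–L79] -/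
theorem ext_of_primitiveForms_eq (L : HasLefschetzProperty h e) (hgr : IsZGrading h) {B₁ B₂ : BilinForm K M}
    (hh₁ : B₁.IsSkewAdjoint h) (he₁ : B₁.IsSkewAdjoint e) (hh₂ : B₂.IsSkewAdjoint h) (he₂ : B₂.IsSkewAdjoint e)
    (hB : ∀ k < finrank K M, ∀ p ∈ primitiveSpace h e k, ∀ q ∈ primitiveSpace h e k,
      B₁ p ((e ^ k) q) = B₂ p ((e ^ k) q)) : B₁ = B₂ := by
  have hs := L.isStringReversal_lefschetzInvolution hgr
  rw [L.eq_stringForm_primitiveForms hgr hs hh₁ he₁ le_rfl, L.eq_stringForm_primitiveForms hgr hs hh₂ he₂ le_rfl]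
  refine L.bilinForm_ext_of_strings hgr fun k₁ p hp a _ k₂ q hq b _ ↦ ?_
  by_cases hk : k₁ = k₂
  · subst hk
    by_cases hkD : k₁ < finrank K M
    · rw [L.stringForm_apply_pow_pow hgr hs hp hq hkD, L.stringForm_apply_pow_pow hgr hs hp hq hkD,
        primitiveForms_apply, primitiveForms_apply, hB k₁ hkD p hp q hq]
    · rw [L.stringForm_apply_pow_primitive_left_of_le hgr hs hp (not_lt.1 hkD),
        L.stringForm_apply_pow_primitive_left_of_le hgr hs hp (not_lt.1 hkD)]
  · rw [L.stringForm_apply_pow_pow_of_ne hgr hs hp hq hk, L.stringForm_apply_pow_pow_of_ne hgr hs hp hq hk]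

/-- **The primitive forms of `φ_β` are the `β_k`** (`k < D`): `φ_β(p, eᵏ q) = β_k(p, q)`.
[cite: LooijengaLunts1997, §1 (1.16) p0008 L77–L79] -/
theorem primitiveForms_stringForm (L : HasLefschetzProperty h e) (hgr : IsZGrading h) (hs : IsStringReversal h e s)
    {β : (k : ℕ) → BilinForm K (primitiveSpace h e k)} {D k : ℕ} (hkD : k < D) :
    primitiveForms h e (L.stringForm hgr hs β D) k = β k := by
  ext p q
  have h1 := L.stringForm_apply_pow_pow hgr hs (β := β) p.2 q.2 hkD 0 k
  rw [pow_zero, Module.End.one_apply, if_pos (zero_add k), pow_zero, one_mul] at h1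
  rw [primitiveForms_apply, h1]

end HasLefschetzProperty

/-! ### §3 The space of invariant forms `≅ Π_{k < D} Bilin(P_{-k})`; its dimension `Σ_k m_k²` -/

variable (h e) in
/-- **The invariant bilinear forms of `(M, h, e)`** — those for which `h` and `e` are skew-adjoint
("`φ` is zero on `M_k × M_l` unless `k + l = 0` and `𝔞` preserves the form `φ` infinitesimally") — as a subspace of
all bilinear forms. [cite: LooijengaLunts1997, §1 (1.3) p0005 L1–L5] -/
def invariantForms : Submodule K (BilinForm K M) where
  carrier := {B | B.IsSkewAdjoint h ∧ B.IsSkewAdjoint e}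
  add_mem' := by
    rintro B₁ B₂ ⟨hh₁, he₁⟩ ⟨hh₂, he₂⟩
    exact ⟨fun x y ↦ by
        show (B₁ + B₂) (h x) y = (B₁ + B₂) x (-(h y))
        rw [LinearMap.add_apply, LinearMap.add_apply, LinearMap.add_apply, LinearMap.add_apply, hh₁ x y, hh₂ x y]
        rfl,
      fun x y ↦ by
        show (B₁ + B₂) (e x) y = (B₁ + B₂) x (-(e y))
        rw [LinearMap.add_apply, LinearMap.add_apply, LinearMap.add_apply, LinearMap.add_apply, he₁ x y, he₂ x y]
        rfl⟩
  zero_mem' := ⟨fun _ _ ↦ by simp, fun _ _ ↦ by simp⟩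
  smul_mem' := by
    rintro c B ⟨hh, he⟩
    exact ⟨fun x y ↦ by
        show (c • B) (h x) y = (c • B) x (-(h y))
        rw [LinearMap.smul_apply, LinearMap.smul_apply, LinearMap.smul_apply, LinearMap.smul_apply, hh x y]
        rfl,
      fun x y ↦ by
        show (c • B) (e x) y = (c • B) x (-(e y))
        rw [LinearMap.smul_apply, LinearMap.smul_apply, LinearMap.smul_apply, LinearMap.smul_apply, he x y]
        rfl⟩

omit [CharZero K] [FiniteDimensional K M] in
/-- Membership in `invariantForms`. [cite: LooijengaLunts1997, §1 (1.3) p0005 L1–L5] -/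
theorem mem_invariantForms_iff : B ∈ invariantForms h e ↔ B.IsSkewAdjoint h ∧ B.IsSkewAdjoint e := Iff.rfl

namespace HasLefschetzProperty

/-- **The invariant forms correspond bijectively and linearly to the families `(β_k)_{k < D}` of bilinear forms
on the primitive spaces** (`D ≥ dim M`): `φ ↦ (φ(·, eᵏ ·)|_{P_{-k}})_k`, with inverse `β ↦ φ_β` — the linear
algebra behind "the 𝔰𝔩(2)-invariant bilinear forms on V(k) are generated by a nonzero (−)^k-symmetric form" for an
arbitrary finite-dimensional module `M ≅ ⊕ₖ V(k) ⊗ P_{-k}`. [cite: LooijengaLunts1997, §1 (1.16) p0008 L77–L79] -/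
def invariantFormsEquiv (L : HasLefschetzProperty h e) (hgr : IsZGrading h) {D : ℕ} (hD : finrank K M ≤ D) :
    invariantForms h e ≃ₗ[K] ((k : Fin D) → BilinForm K (primitiveSpace h e k)) := by
  classical
  have hs := L.isStringReversal_lefschetzInvolution hgr
  refine LinearEquiv.ofLinear
    { toFun := fun B k ↦ primitiveForms h e (B : BilinForm K M) k
      map_add' := fun B₁ B₂ ↦ by ext k p q; rfl
      map_smul' := fun c B ↦ by ext k p q; rfl }
    { toFun := fun β ↦ ⟨L.stringForm hgr hs (fun k ↦ if hk : k < D then β ⟨k, hk⟩ else 0) D,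
        L.isSkewAdjoint_stringForm_h hgr hs, L.isSkewAdjoint_stringForm_e hgr hs⟩
      map_add' := fun β₁ β₂ ↦ by
        refine Subtype.ext (L.bilinForm_ext_of_strings hgr fun k₁ p hp a _ k₂ q hq b _ ↦ ?_)
        simp only [Submodule.coe_add, LinearMap.add_apply]
        by_cases hk : k₁ = k₂
        · subst hk
          by_cases hkD : k₁ < D
          · simp only [L.stringForm_apply_pow_pow hgr hs hp hq hkD, dif_pos hkD, Pi.add_apply,
              LinearMap.add_apply]
            split_ifs <;> ring
          · simp only [L.stringForm_apply_pow_primitive_left_of_le hgr hs hp (not_lt.1 hkD), add_zero]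
        · simp only [L.stringForm_apply_pow_pow_of_ne hgr hs hp hq hk, add_zero]
      map_smul' := fun c β ↦ by
        refine Subtype.ext (L.bilinForm_ext_of_strings hgr fun k₁ p hp a _ k₂ q hq b _ ↦ ?_)
        simp only [Submodule.coe_smul, LinearMap.smul_apply, RingHom.id_apply, smul_eq_mul]
        by_cases hk : k₁ = k₂
        · subst hk
          by_cases hkD : k₁ < D
          · simp only [L.stringForm_apply_pow_pow hgr hs hp hq hkD, dif_pos hkD, Pi.smul_apply,
              LinearMap.smul_apply, smul_eq_mul]
            split_ifs <;> ring
          · simp only [L.stringForm_apply_pow_primitive_left_of_le hgr hs hp (not_lt.1 hkD), mul_zero]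
        · simp only [L.stringForm_apply_pow_pow_of_ne hgr hs hp hq hk, mul_zero] }
    ?_ ?_
  · -- `primitiveForms ∘ stringForm = id`
    refine LinearMap.ext fun β ↦ funext fun k ↦ ?_
    simp only [LinearMap.coe_comp, LinearMap.coe_mk, AddHom.coe_mk, Function.comp_apply, LinearMap.id_apply]
    rw [L.primitiveForms_stringForm hgr hs k.2, dif_pos k.2]
  · -- `stringForm ∘ primitiveForms = id` on invariant forms
    refine LinearMap.ext fun B ↦ Subtype.ext ?_
    simp only [LinearMap.coe_comp, LinearMap.coe_mk, AddHom.coe_mk, Function.comp_apply, LinearMap.id_apply]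
    refine L.bilinForm_ext_of_strings hgr fun k₁ p hp a _ k₂ q hq b _ ↦ ?_
    by_cases hk : k₁ = k₂
    · subst hk
      by_cases hkD : k₁ < D
      · rw [L.stringForm_apply_pow_pow hgr hs hp hq hkD, dif_pos hkD,
          apply_pow_primitive_pow_primitive L B.2.1 B.2.2 hp hq, primitiveForms_apply]
      · rw [L.stringForm_apply_pow_primitive_left_of_le hgr hs hp (not_lt.1 hkD),
          L.primitive_eq_zero_of_finrank_le (le_trans hD (not_lt.1 hkD)) hp, map_zero, map_zero,
          LinearMap.zero_apply]
    · rw [L.stringForm_apply_pow_pow_of_ne hgr hs hp hq hk,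
        apply_pow_primitive_pow_primitive_of_ne L B.2.1 B.2.2 hp hq hk]

/-- The equivalence reads off the primitive forms. [cite: LooijengaLunts1997, §1 (1.16) p0008 L77–L79] -/
theorem invariantFormsEquiv_apply (L : HasLefschetzProperty h e) (hgr : IsZGrading h) {D : ℕ}
    (hD : finrank K M ≤ D) (B : invariantForms h e) (k : Fin D) :
    L.invariantFormsEquiv hgr hD B k = primitiveForms h e (B : BilinForm K M) k := rfl

/-- **The dimension of the space of invariant bilinear forms is `Σ_{k < D} m_k²`**, `m_k = dim P_{-k}` the
multiplicity of `V(k)` (`D ≥ dim M`; `Hom_{𝔰𝔩₂}(V(k) ⊗ V(l), K)` is `K` for `k = l` and `0` otherwise).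
[cite: LooijengaLunts1997, §1 (1.16) p0008 L77–L79] -/
theorem finrank_invariantForms (L : HasLefschetzProperty h e) (hgr : IsZGrading h) {D : ℕ}
    (hD : finrank K M ≤ D) :
    finrank K (invariantForms h e) = ∑ k : Fin D, finrank K (primitiveSpace h e k) ^ 2 := by
  rw [(L.invariantFormsEquiv hgr hD).finrank_eq, Module.finrank_pi_fintype]
  refine Finset.sum_congr rfl fun k _ ↦ ?_
  rw [Module.finrank_linearMap, Module.finrank_linearMap_self, sq]

end HasLefschetzProperty

/-! ### §4 Symmetry and non-degeneracy read off the primitive forms -/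

section Transfer

/-- **`φᵀ = εφ` if and only if every primitive form `β_k` is `ε(-1)^k`-symmetric** ("only if": A1-125
`primitiveForm_apply_swap`; "if": `φ = φ_β` and §2 of `LefschetzInvariantFormExistence`).
[cite: LooijengaLunts1997, §1 (1.16) p0008 L77–L83] -/
theorem flip_eq_smul_iff_primitiveForms (L : HasLefschetzProperty h e) (hgr : IsZGrading h)
    (hh : B.IsSkewAdjoint h) (he : B.IsSkewAdjoint e) (ε : K) :
    LinearMap.flip B = ε • B ↔ ∀ k < finrank K M, ∀ p ∈ primitiveSpace h e k, ∀ q ∈ primitiveSpace h e k,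
      B q ((e ^ k) p) = ε * (-1) ^ k * B p ((e ^ k) q) := by
  refine ⟨fun hflip k _ p _ q _ ↦ primitiveForm_apply_swap he hflip k p q, fun hβ ↦ ?_⟩
  have hs := L.isStringReversal_lefschetzInvolution hgr
  rw [L.eq_stringForm_primitiveForms hgr hs hh he le_rfl]
  exact L.flip_stringForm hgr hs fun k hk u v ↦ by
    rw [primitiveForms_apply, primitiveForms_apply]
    exact hβ k hk (u : M) u.2 (v : M) v.2

/-- **`φ` is non-degenerate if and only if it is `ε`-symmetric-compatible …** — in the reflexive case: for an
invariant `φ` with `φᵀ = εφ`, `φ` is non-degenerate iff every primitive form `β_k` (`k < dim M`) is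
left-separating on `P_{-k}` ("only if": A1-125 `exists_primitive_apply_pow_ne_zero`; "if": `φ = φ_β`).
[cite: LooijengaLunts1997, §1 (1.16) p0008 L77–L83] -/
theorem nondegenerate_iff_primitiveForms (L : HasLefschetzProperty h e) (hgr : IsZGrading h)
    (hh : B.IsSkewAdjoint h) (he : B.IsSkewAdjoint e) {ε : K} (hflip : LinearMap.flip B = ε • B) :
    B.Nondegenerate ↔ ∀ k < finrank K M, (primitiveForms h e B k).SeparatingLeft := by
  constructor
  · intro hB k _ p hp
    by_contra hp0
    have hp0' : (p : M) ≠ 0 := fun h0 ↦ hp0 (Subtype.ext h0)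
    obtain ⟨q, hq, hne⟩ := exists_primitive_apply_pow_ne_zero hgr L hh he hB.1 p.2 hp0'
    exact hne (hp ⟨q, hq⟩)
  · intro hβ
    have hs := L.isStringReversal_lefschetzInvolution hgr
    rw [L.eq_stringForm_primitiveForms hgr hs hh he le_rfl]
    exact L.nondegenerate_stringForm hgr hs le_rfl hβ (ε := ε) fun k _ u v ↦ by
      rw [primitiveForms_apply, primitiveForms_apply]
      exact primitiveForm_apply_swap he hflip k (u : M) (v : M)

end Transfer

end Classification

/-! ### §5 Bridge: the string coordinates of `*_L` are the matrix units `E⁽ᵏ⁾_{0i}` of `LefschetzModuleKleimanAlgebraMatrix` -/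

section Bridge

variable [CharZero K] [FiniteDimensional K M]

namespace HasLefschetzProperty

/-- **`C_{k,i}` for André's `*_L` is the matrix unit `E⁽ᵏ⁾_{0,i} = e⁰ π_k Nⁱ`** of
`LefschetzModuleKleimanAlgebraMatrix.lean` (row g30-#5 of seat `lit-hodgefound-p34`; the two operators were introduced
concurrently — this is the bridge asked for by the review of A1-128): they agree on every string vector.
[cite: Andre1996Motifs, Prop. 1.2 (p. 12, proof: the matrix units on P^{d-i} ⊗ ℚ^{i+1})] -/
theorem stringCoord_lefschetzInvolution_eq_stringUnit (L : HasLefschetzProperty h e) (hgr : IsZGrading h) (k i : ℕ) :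
    stringCoord e (L.lefschetzInvolution hgr) k i = L.stringUnit hgr k 0 i := by
  have hs := L.isStringReversal_lefschetzInvolution hgr
  refine L.linearMap_ext_of_strings hgr fun k' p hp j hj ↦ ?_
  rw [hs.stringCoord_apply_pow_primitive hp hj, L.stringUnit_apply_pow_primitive hgr k 0 i hp hj, pow_zero,
    Module.End.one_apply]
  by_cases hc : j = i ∧ k' = k
  · rw [if_pos hc, if_pos ⟨hc.2, hc.1⟩]
  · rw [if_neg hc, if_neg fun h' ↦ hc ⟨h'.2, h'.1⟩]

/-- … and `C_{k,0}` for `*_L` is the projector `π_k` onto `P_{-k}` of that file.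
[cite: Andre1996Motifs, Prop. 1.2 (p. 12, proof)] -/
theorem stringCoord_lefschetzInvolution_zero_eq_primitiveProj (L : HasLefschetzProperty h e) (hgr : IsZGrading h)
    (k : ℕ) : stringCoord e (L.lefschetzInvolution hgr) k 0 = L.primitiveProj hgr k := by
  rw [L.stringCoord_lefschetzInvolution_eq_stringUnit hgr, stringUnit, pow_zero, one_mul, pow_zero, mul_one]

end HasLefschetzProperty

end Bridge

end Literature.Algebra.Lie
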